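import Summits.CriticalPhenomena.PercolationContinuityZ3.Theorems.PercNearOneGluingNoHeavyLowerTailCubicFourPointL1ThmCertData
import Summits.CriticalPhenomena.PercolationContinuityZ3.Theorems.PercNearOneGluingNoHeavyLowerTailCubicFourPointL1FullCert
import Summits.CriticalPhenomena.PercolationContinuityZ3.Theorems.PercNearOneGluingNoHeavyLowerTailFourPointFaceDefs
import Summits.CriticalPhenomena.PercolationContinuityZ3.Theorems.PercNearOneGluingNoHeavyLowerTailCubicThreePointBernsteinStep
import Mathlib.Data.Real.Basic
import Mathlib.Tactic.Linarith
import Mathlib.Tactic.Positivity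
import Mathlib.Tactic.LinearCombination
import HarnessLib

/-!
# `NoHeavyLowerTail` (stmt-CriticalPhenomena-4575) — (L1) from THEOREM rows only: kernel replay of prim-l12-p6's exact degree-5 certificate

Support file (prover prim-cert-2, certificate seat; `--supports stmt-CriticalPhenomena-4575`).  No sorries, no named facts, standard axioms
(`decide +kernel`; no `native_decide`).  Engine `…FaceCertKernel`; sister file `…CubicFourPointL1FullCert` (prim-facecert's certificate, which
still used three increasing-event Sahi rows as hypotheses — superseded by this one for the purpose of proving (L1)).

THE CERTIFICATE (prim-l12-p6 `certs/cert_L1_thmrows_exact.json`, 2026-08-20; face-respecting degree-5 LP with the dictionary RESTRICTED TO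
THEOREM ROWS; HiGHS IPM, vertex on the support, exact solve; verified by two independent exact engines): on the region `x₂ = a|b|cy ≤ x₃ = a|by|c`
there are polynomials `M` (96 quadratic monomials, vanishing exactly on the `b`-isolated face), `m_r = mA_r + (x₃ − x₂)·mB_r` and
`C = cA + (x₃ − x₂)·cB`, all with NONNEGATIVE coefficients, such that, exactly,
    `M · polL₁ = Σ_r m_r · g_r + C`                                                            (`identity`)
where the 16 rows `g_r` are ALL THEOREMS of the tree on realizable four-point laws:
* Aas–Gladkov `AG = q t − e₂(u) ≥ 0` on the 3-point marginals `(a,b,c), (a,b,y), (a,c,y), (b,c,y)` and on `({a,y},b,c)` (quotient `a = y`,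
  = the graph with the edge `ay` made sure) [`prodBernoulli_threePoint_strongHarris`];
* the hybrid/group three-point lower bound `E₃({P₁≁c′},{c′≁P₃},{P₁≁P₃′}) ≥ 0`, `P₃ ⊆ P₃′` [`HybridThreePointLB.sahiE3_hybrid_nonneg`], in the ten
  instances `(P₁;c′;P₃;P₃′)` = `(b;a;c;c)`, `(b;a;y;y)`, `(b;a;cy;cy)`, `(c;a;by;by)`, `(c;b;y;y)`, `(c;b;ay;ay)`, `(y;b;a;ac)`, `(y;b;ac;ac)`,
  `(b;c;a;ay)` [= `hybE₁`], `(y;c;a;ab)`, written `E3h σ m₁ m₂ m₃ m₁₂ m₁₃ m₂₃ m₁₂₃` on the cell sums of the three separation events (or as `hybE₁`);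
* the same bound on the quotient `a = y`, instance `(b;{a,y};c;c)` = `E₃(D[ay|b], D[ay|c], D[b|c])` [= `hybE₃g`, also `GroupThreePointLB`].
HOW IT IS CHECKED.  Rows and target are core `grind` syntax trees (`Lean.Grind.CommRing.Expr`) transcribing the tree definitions node by node
(`eL1.denote (ctx15 x) = polL₁ x` etc. by `rfl`); `FaceCertKernel.toPP` evaluates them to packed polynomials (Gödel-coded monomials), the
multipliers act by `applyT` (balanced merges), and `check : subCheckP lhs rhs = true` is ONE `decide +kernel`.  Soundness = `FaceCertKernel.denote_*`.
RESULTS. `identity` (any commutative ring); `polL₁_nonneg_regionA`: for real cells `≥ 0` with `x₂ ≤ x₃`, the 16 row inequalities imply `0 ≤ polL₁`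
(on the `b`-isolated face `polL₁ = 0` directly; elsewhere `M > 0`).  The mirror region, the region-free statement and the `HybMasses` dialect are in
`…CubicFourPointL1ThmCertAll`.  NOT here: the measure-level transfer to `PolarisedRowL1` (15-cell decomposition of the four-point law + the 16
row theorems at the law + the quotient as a forced edge).  [folklore] (Positivstellensatz certificate, replayed by reflection)
-/

open Lean.Grind.CommRing (Expr)

namespace Summit.CriticalPhenomena.PercolationContinuityZ3.Theorems

namespace L1ThmCert

open CubicFourPoint FaceCertKernel

/-- Reflected row `HYB(P1=b;c=a;P3=y;P3'=y)` (CubicThreePointStep.F (x₁ + x₂ + x₄ + x₆…). -/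
noncomputable def e_Faby : Expr :=
  (.sub (.mul (.add (.add (.add (.add (.add (.add (.add (.add (.var 0) (.var 1)) (.var 3)) (.var 5)) (.add (.add (.var 6) (.var 11)) (.var 13))) (.add (.add (.var 4) (.var 8)) (.var 10))) (.add (.add (.var 2) (.var 7)) (.var 9))) (.add (.var 12) (.var 14))) (.add (.var 12) (.var 14))) (.sub (.mul (.add (.add (.add (.var 0) (.var 1)) (.var 3)) (.var 5)) (.add (.var 12) (.var 14))) (.add (.add (.mul (.add (.add (.var 6) (.var 11)) (.var 13)) (.add (.add (.var 4) (.var 8)) (.var 10))) (.mul (.add (.add (.var 6) (.var 11)) (.var 13)) (.add (.add (.var 2) (.var 7)) (.var 9)))) (.mul (.add (.add (.var 4) (.var 8)) (.var 10)) (.add (.add (.var 2) (.var 7)) (.var 9)))))) (.mul (.mul (.add (.add (.var 6) (.var 11)) (.var 13)) (.add (.add (.var 4) (.var 8)) (.var 10))) (.add (.add (.var 2) (.var 7)) (.var 9))))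

/-- Reflected row `HYB(P1=b;c=a;P3=cy;P3'=cy)` (E3h (x₁ + x₂ + x₃ + x₄ + x₅ + x₆ + x₇ + …). -/
noncomputable def e_H_b_a_cy_cy : Expr :=
  (.sub (.add (.mul (.mul (.num 2) (.pow (.add (.add (.add (.add (.add (.add (.add (.add (.add (.add (.add (.add (.add (.add (.var 0) (.var 1)) (.var 2)) (.var 3)) (.var 4)) (.var 5)) (.var 6)) (.var 7)) (.var 8)) (.var 9)) (.var 10)) (.var 11)) (.var 12)) (.var 13)) (.var 14)) 2)) (.add (.var 0) (.var 1))) (.mul (.mul (.add (.add (.add (.add (.add (.add (.add (.add (.add (.var 0) (.var 1)) (.var 2)) (.var 3)) (.var 4)) (.var 5)) (.var 7)) (.var 8)) (.var 9)) (.var 10)) (.add (.add (.add (.add (.add (.add (.var 0) (.var 1)) (.var 2)) (.var 3)) (.var 6)) (.var 7)) (.var 11))) (.add (.add (.add (.add (.add (.add (.var 0) (.var 1)) (.var 4)) (.var 5)) (.var 6)) (.var 10)) (.var 11)))) (.mul (.add (.add (.add (.add (.add (.add (.add (.add (.add (.add (.add (.add (.add (.add (.var 0) (.var 1)) (.var 2))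 (.var 3)) (.var 4)) (.var 5)) (.var 6)) (.var 7)) (.var 8)) (.var 9)) (.var 10)) (.var 11)) (.var 12)) (.var 13)) (.var 14)) (.add (.add (.mul (.add (.add (.add (.add (.add (.add (.add (.add (.add (.var 0) (.var 1)) (.var 2)) (.var 3)) (.var 4)) (.var 5)) (.var 7)) (.var 8)) (.var 9)) (.var 10)) (.add (.add (.add (.var 0) (.var 1)) (.var 6)) (.var 11))) (.mul (.add (.add (.add (.add (.add (.add (.var 0) (.var 1)) (.var 2)) (.var 3)) (.var 6)) (.var 7)) (.var 11)) (.add (.add (.add (.add (.var 0) (.var 1)) (.var 4)) (.var 5)) (.var 10)))) (.mul (.add (.add (.add (.add (.add (.add (.var 0) (.var 1)) (.var 4)) (.var 5)) (.var 6)) (.var 10)) (.var 11)) (.add (.add (.add (.add (.var 0) (.var 1)) (.var 2)) (.var 3)) (.var 7))))))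

/-- Reflected row `HYB(P1=c;c=a;P3=by;P3'=by)` (E3h (x₁ + x₂ + x₃ + x₄ + x₅ + x₆ + x₇ + …). -/
noncomputable def e_H_c_a_by_by : Expr :=
  (.sub (.add (.mul (.mul (.num 2) (.pow (.add (.add (.add (.add (.add (.add (.add (.add (.add (.add (.add (.add (.add (.add (.var 0) (.var 1)) (.var 2)) (.var 3)) (.var 4)) (.var 5)) (.var 6)) (.var 7)) (.var 8)) (.var 9)) (.var 10)) (.var 11)) (.var 12)) (.var 13)) (.var 14)) 2)) (.add (.var 0) (.var 2))) (.mul (.mul (.add (.add (.add (.add (.add (.add (.add (.add (.add (.var 0) (.var 1)) (.var 2)) (.var 3)) (.var 4)) (.var 6)) (.var 7)) (.var 8)) (.var 11)) (.var 12)) (.add (.add (.add (.add (.add (.add (.var 0) (.var 1)) (.var 2)) (.var 3)) (.var 5)) (.var 7)) (.var 9))) (.add (.add (.add (.add (.add (.add (.var 0) (.var 2)) (.var 4)) (.var 5)) (.var 6)) (.var 9)) (.var 12)))) (.mul (.add (.add (.add (.add (.add (.add (.add (.add (.add (.add (.add (.add (.add (.add (.var 0) (.var 1)) (.var 2)) (.var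 3)) (.var 4)) (.var 5)) (.var 6)) (.var 7)) (.var 8)) (.var 9)) (.var 10)) (.var 11)) (.var 12)) (.var 13)) (.var 14)) (.add (.add (.mul (.add (.add (.add (.add (.add (.add (.add (.add (.add (.var 0) (.var 1)) (.var 2)) (.var 3)) (.var 4)) (.var 6)) (.var 7)) (.var 8)) (.var 11)) (.var 12)) (.add (.add (.add (.var 0) (.var 2)) (.var 5)) (.var 9))) (.mul (.add (.add (.add (.add (.add (.add (.var 0) (.var 1)) (.var 2)) (.var 3)) (.var 5)) (.var 7)) (.var 9)) (.add (.add (.add (.add (.var 0) (.var 2)) (.var 4)) (.var 6)) (.var 12)))) (.mul (.add (.add (.add (.add (.add (.add (.var 0) (.var 2)) (.var 4)) (.var 5)) (.var 6)) (.var 9)) (.var 12)) (.add (.add (.add (.add (.var 0) (.var 1)) (.var 2)) (.var 3)) (.var 7))))))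

/-- Reflected row `HYB(P1=c;c=b;P3=y;P3'=y)` (CubicThreePointStep.F (x₁ + x₅ + x₆ + x₇…). -/
noncomputable def e_Fbcy : Expr :=
  (.sub (.mul (.add (.add (.add (.add (.add (.add (.add (.add (.var 0) (.var 4)) (.var 5)) (.var 6)) (.add (.add (.var 3) (.var 8)) (.var 13))) (.add (.add (.var 2) (.var 9)) (.var 12))) (.add (.add (.var 1) (.var 10)) (.var 11))) (.add (.var 7) (.var 14))) (.add (.var 7) (.var 14))) (.sub (.mul (.add (.add (.add (.var 0) (.var 4)) (.var 5)) (.var 6)) (.add (.var 7) (.var 14))) (.add (.add (.mul (.add (.add (.var 3) (.var 8)) (.var 13)) (.add (.add (.var 2) (.var 9)) (.var 12))) (.mul (.add (.add (.var 3) (.var 8)) (.var 13)) (.add (.add (.var 1) (.var 10)) (.var 11)))) (.mul (.add (.add (.var 2) (.var 9)) (.var 12)) (.add (.add (.var 1) (.var 10)) (.var 11)))))) (.mul (.mul (.add (.add (.var 3) (.var 8)) (.var 13)) (.add (.add (.var 2) (.var 9)) (.var 12))) (.add (.add (.var 1) (.var 10)) (.var 11))))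

/-- Reflected row `HYB(P1=y;c=b;P3=a;P3'=ac)` (E3h (x₁ + x₂ + x₃ + x₄ + x₅ + x₆ + x₇ + …). -/
noncomputable def e_H_y_b_a_ac : Expr :=
  (.sub (.add (.mul (.mul (.num 2) (.pow (.add (.add (.add (.add (.add (.add (.add (.add (.add (.add (.add (.add (.add (.add (.var 0) (.var 1)) (.var 2)) (.var 3)) (.var 4)) (.var 5)) (.var 6)) (.var 7)) (.var 8)) (.var 9)) (.var 10)) (.var 11)) (.var 12)) (.var 13)) (.var 14)) 2)) (.add (.add (.var 0) (.var 3)) (.var 5))) (.mul (.mul (.add (.add (.add (.add (.add (.add (.add (.add (.add (.var 0) (.var 1)) (.var 3)) (.var 4)) (.var 5)) (.var 6)) (.var 8)) (.var 10)) (.var 11)) (.var 13)) (.add (.add (.add (.add (.add (.add (.add (.add (.add (.var 0) (.var 1)) (.var 2)) (.var 3)) (.var 4)) (.var 5)) (.var 7)) (.var 8)) (.var 9)) (.var 10))) (.add (.add (.add (.add (.add (.add (.var 0) (.var 2)) (.var 3)) (.var 5)) (.var 6)) (.var 9)) (.var 13)))) (.mul (.add (.add (.add (.add (.add (.add (.add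 (.add (.add (.add (.add (.add (.add (.add (.var 0) (.var 1)) (.var 2)) (.var 3)) (.var 4)) (.var 5)) (.var 6)) (.var 7)) (.var 8)) (.var 9)) (.var 10)) (.var 11)) (.var 12)) (.var 13)) (.var 14)) (.add (.add (.mul (.add (.add (.add (.add (.add (.add (.add (.add (.add (.var 0) (.var 1)) (.var 3)) (.var 4)) (.var 5)) (.var 6)) (.var 8)) (.var 10)) (.var 11)) (.var 13)) (.add (.add (.add (.add (.var 0) (.var 2)) (.var 3)) (.var 5)) (.var 9))) (.mul (.add (.add (.add (.add (.add (.add (.add (.add (.add (.var 0) (.var 1)) (.var 2)) (.var 3)) (.var 4)) (.var 5)) (.var 7)) (.var 8)) (.var 9)) (.var 10)) (.add (.add (.add (.add (.var 0) (.var 3)) (.var 5)) (.var 6)) (.var 13)))) (.mul (.add (.add (.add (.add (.add (.add (.var 0) (.var 2)) (.var 3)) (.var 5)) (.var 6)) (.var 9)) (.var 13)) (.add (.add (.add (.add (.add (.add (.var 0) (.var 1)) (.var 3)) (.var 4)) (.var 5)) (.var 8)) (.var 10))))))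

/-- Reflected row `HYB(P1=y;c=b;P3=ac;P3'=ac)` (E3h (x₁ + x₂ + x₃ + x₄ + x₅ + x₆ + x₇ + …). -/
noncomputable def e_H_y_b_ac_ac : Expr :=
  (.sub (.add (.mul (.mul (.num 2) (.pow (.add (.add (.add (.add (.add (.add (.add (.add (.add (.add (.add (.add (.add (.add (.var 0) (.var 1)) (.var 2)) (.var 3)) (.var 4)) (.var 5)) (.var 6)) (.var 7)) (.var 8)) (.var 9)) (.var 10)) (.var 11)) (.var 12)) (.var 13)) (.var 14)) 2)) (.add (.var 0) (.var 5))) (.mul (.mul (.add (.add (.add (.add (.add (.add (.add (.add (.add (.var 0) (.var 1)) (.var 3)) (.var 4)) (.var 5)) (.var 6)) (.var 8)) (.var 10)) (.var 11)) (.var 13)) (.add (.add (.add (.add (.add (.add (.var 0) (.var 1)) (.var 2)) (.var 4)) (.var 5)) (.var 9)) (.var 10))) (.add (.add (.add (.add (.add (.add (.var 0) (.var 2)) (.var 3)) (.var 5)) (.var 6)) (.var 9)) (.var 13)))) (.mul (.add (.add (.add (.add (.add (.add (.add (.add (.add (.add (.add (.add (.add (.add (.var 0) (.var 1)) (.var 2))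 (.var 3)) (.var 4)) (.var 5)) (.var 6)) (.var 7)) (.var 8)) (.var 9)) (.var 10)) (.var 11)) (.var 12)) (.var 13)) (.var 14)) (.add (.add (.mul (.add (.add (.add (.add (.add (.add (.add (.add (.add (.var 0) (.var 1)) (.var 3)) (.var 4)) (.var 5)) (.var 6)) (.var 8)) (.var 10)) (.var 11)) (.var 13)) (.add (.add (.add (.var 0) (.var 2)) (.var 5)) (.var 9))) (.mul (.add (.add (.add (.add (.add (.add (.var 0) (.var 1)) (.var 2)) (.var 4)) (.var 5)) (.var 9)) (.var 10)) (.add (.add (.add (.add (.var 0) (.var 3)) (.var 5)) (.var 6)) (.var 13)))) (.mul (.add (.add (.add (.add (.add (.add (.var 0) (.var 2)) (.var 3)) (.var 5)) (.var 6)) (.var 9)) (.var 13)) (.add (.add (.add (.add (.var 0) (.var 1)) (.var 4)) (.var 5)) (.var 10))))))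

/-- Reflected row `HYB(P1=y;c=c;P3=a;P3'=ab)` (E3h (x₁ + x₂ + x₃ + x₄ + x₅ + x₆ + x₇ + …). -/
noncomputable def e_H_y_c_a_ab : Expr :=
  (.sub (.add (.mul (.mul (.num 2) (.pow (.add (.add (.add (.add (.add (.add (.add (.add (.add (.add (.add (.add (.add (.add (.var 0) (.var 1)) (.var 2)) (.var 3)) (.var 4)) (.var 5)) (.var 6)) (.var 7)) (.var 8)) (.var 9)) (.var 10)) (.var 11)) (.var 12)) (.var 13)) (.var 14)) 2)) (.add (.add (.var 0) (.var 3)) (.var 6))) (.mul (.mul (.add (.add (.add (.add (.add (.add (.add (.add (.add (.var 0) (.var 2)) (.var 3)) (.var 4)) (.var 5)) (.var 6)) (.var 8)) (.var 9)) (.var 12)) (.var 13)) (.add (.add (.add (.add (.add (.add (.add (.add (.add (.var 0) (.var 1)) (.var 2)) (.var 3)) (.var 4)) (.var 6)) (.var 7)) (.var 8)) (.var 11)) (.var 12))) (.add (.add (.add (.add (.add (.add (.var 0) (.var 1)) (.var 3)) (.var 5)) (.var 6)) (.var 11)) (.var 13)))) (.mul (.add (.add (.add (.add (.add (.add (.add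 (.add (.add (.add (.add (.add (.add (.add (.var 0) (.var 1)) (.var 2)) (.var 3)) (.var 4)) (.var 5)) (.var 6)) (.var 7)) (.var 8)) (.var 9)) (.var 10)) (.var 11)) (.var 12)) (.var 13)) (.var 14)) (.add (.add (.mul (.add (.add (.add (.add (.add (.add (.add (.add (.add (.var 0) (.var 2)) (.var 3)) (.var 4)) (.var 5)) (.var 6)) (.var 8)) (.var 9)) (.var 12)) (.var 13)) (.add (.add (.add (.add (.var 0) (.var 1)) (.var 3)) (.var 6)) (.var 11))) (.mul (.add (.add (.add (.add (.add (.add (.add (.add (.add (.var 0) (.var 1)) (.var 2)) (.var 3)) (.var 4)) (.var 6)) (.var 7)) (.var 8)) (.var 11)) (.var 12)) (.add (.add (.add (.add (.var 0) (.var 3)) (.var 5)) (.var 6)) (.var 13)))) (.mul (.add (.add (.add (.add (.add (.add (.var 0) (.var 1)) (.var 3)) (.var 5)) (.var 6)) (.var 11)) (.var 13)) (.add (.add (.add (.add (.add (.add (.var 0) (.var 2)) (.var 3)) (.var 4)) (.var 6)) (.var 8)) (.var 12))))))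

/-- Reflected `Σ_{i ∉ S} xᵢ²`, the lower bound used for `M` (`S` = the five `b`-isolated cells). -/
noncomputable def eSq : Expr :=
  (.add (.add (.add (.add (.add (.add (.add (.add (.add (.pow (.var 2) 2) (.pow (.var 3) 2)) (.pow (.var 6) 2)) (.pow (.var 7) 2)) (.pow (.var 8) 2)) (.pow (.var 9) 2)) (.pow (.var 11) 2)) (.pow (.var 12) 2)) (.pow (.var 13) 2)) (.pow (.var 14) 2))

/-- All reflected expressions use variables `< 15` only. -/
theorem wf_all : wfE L1FullCert.eL1 = true ∧ wfE L1FullCert.e_Fabc = true ∧ wfE e_Faby = true ∧ wfE e_H_b_a_cy_cy = true ∧ wfE e_H_c_a_by_by = true ∧ wfE e_Fbcy = true ∧ wfE L1FullCert.e_E3g = true ∧ wfE e_H_y_b_a_ac = true ∧ wfE e_H_y_b_ac_ac = true ∧ wfE L1FullCert.e_E1 = true ∧ wfE e_H_y_c_a_ab = true ∧ wfE L1FullCert.e_Fe = true ∧ wfE L1FullCert.e_AGabc = true ∧ wfE L1FullCert.e_AGaby = true ∧ wfE L1FullCert.e_AGacy = true ∧ wfE L1FullCert.e_AGbcy = true ∧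 wfE L1FullCert.e_AGe = true ∧ wfE eSq = true := by
  decide +kernel

section Bridges

variable {R : Type*} [CommRing R]

/-- Bridge (by `rfl`): the reflected row `Faby` denotes its tree form. -/
theorem e_Faby_denote (x₁ x₂ x₃ x₄ x₅ x₆ x₇ x₈ x₉ x₁₀ x₁₁ x₁₂ x₁₃ x₁₄ x₁₅ : R) : (e_Faby).denote (ctx15 x₁ x₂ x₃ x₄ x₅ x₆ x₇ x₈ x₉ x₁₀ x₁₁ x₁₂ x₁₃ x₁₄ x₁₅) = CubicThreePointStep.F (x₁ + x₂ + x₄ + x₆) (x₇ + x₁₂ + x₁₄) (x₅ + x₉ + x₁₁) (x₃ + x₈ + x₁₀) (x₁₃ + x₁₅) := rfl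

/-- Bridge (by `rfl`): the reflected row `H_b_a_cy_cy` denotes its tree form. -/
theorem e_H_b_a_cy_cy_denote (x₁ x₂ x₃ x₄ x₅ x₆ x₇ x₈ x₉ x₁₀ x₁₁ x₁₂ x₁₃ x₁₄ x₁₅ : R) : (e_H_b_a_cy_cy).denote (ctx15 x₁ x₂ x₃ x₄ x₅ x₆ x₇ x₈ x₉ x₁₀ x₁₁ x₁₂ x₁₃ x₁₄ x₁₅) = E3h (x₁ + x₂ + x₃ + x₄ + x₅ + x₆ + x₇ + x₈ + x₉ + x₁₀ + x₁₁ + x₁₂ + x₁₃ + x₁₄ + x₁₅) (x₁ + x₂ + x₃ + x₄ + x₅ + x₆ + x₈ + x₉ + x₁₀ + x₁₁) (x₁ + x₂ + x₃ + x₄ + x₇ + x₈ + x₁₂) (x₁ + x₂ + x₅ + x₆ + x₇ + x₁₁ + x₁₂) (x₁ + x₂ + x₃ + x₄ + x₈) (x₁ + x₂ + x₅ + x₆ + x₁₁) (x₁ + x₂ + x₇ + x₁₂) (x₁ + x₂) := rfl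

/-- Bridge (by `rfl`): the reflected row `H_c_a_by_by` denotes its tree form. -/
theorem e_H_c_a_by_by_denote (x₁ x₂ x₃ x₄ x₅ x₆ x₇ x₈ x₉ x₁₀ x₁₁ x₁₂ x₁₃ x₁₄ x₁₅ : R) : (e_H_c_a_by_by).denote (ctx15 x₁ x₂ x₃ x₄ x₅ x₆ x₇ x₈ x₉ x₁₀ x₁₁ x₁₂ x₁₃ x₁₄ x₁₅) = E3h (x₁ + x₂ + x₃ + x₄ + x₅ + x₆ + x₇ + x₈ + x₉ + x₁₀ + x₁₁ + x₁₂ + x₁₃ + x₁₄ + x₁₅) (x₁ + x₂ + x₃ + x₄ + x₅ + x₇ + x₈ + x₉ + x₁₂ + x₁₃) (x₁ + x₂ + x₃ + x₄ + x₆ + x₈ + x₁₀) (x₁ + x₃ + x₅ + x₆ + x₇ + x₁₀ + x₁₃) (x₁ + x₂ + x₃ + x₄ + x₈) (x₁ + x₃ + x₅ + x₇ + x₁₃) (x₁ + x₃ + x₆ + x₁₀) (x₁ + x₃) := rfl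

/-- Bridge (by `rfl`): the reflected row `Fbcy` denotes its tree form. -/
theorem e_Fbcy_denote (x₁ x₂ x₃ x₄ x₅ x₆ x₇ x₈ x₉ x₁₀ x₁₁ x₁₂ x₁₃ x₁₄ x₁₅ : R) : (e_Fbcy).denote (ctx15 x₁ x₂ x₃ x₄ x₅ x₆ x₇ x₈ x₉ x₁₀ x₁₁ x₁₂ x₁₃ x₁₄ x₁₅) = CubicThreePointStep.F (x₁ + x₅ + x₆ + x₇) (x₄ + x₉ + x₁₄) (x₃ + x₁₀ + x₁₃) (x₂ + x₁₁ + x₁₂) (x₈ + x₁₅) := rfl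

/-- Bridge (by `rfl`): the reflected row `H_y_b_a_ac` denotes its tree form. -/
theorem e_H_y_b_a_ac_denote (x₁ x₂ x₃ x₄ x₅ x₆ x₇ x₈ x₉ x₁₀ x₁₁ x₁₂ x₁₃ x₁₄ x₁₅ : R) : (e_H_y_b_a_ac).denote (ctx15 x₁ x₂ x₃ x₄ x₅ x₆ x₇ x₈ x₉ x₁₀ x₁₁ x₁₂ x₁₃ x₁₄ x₁₅) = E3h (x₁ + x₂ + x₃ + x₄ + x₅ + x₆ + x₇ + x₈ + x₉ + x₁₀ + x₁₁ + x₁₂ + x₁₃ + x₁₄ + x₁₅) (x₁ + x₂ + x₄ + x₅ + x₆ + x₇ + x₉ + x₁₁ + x₁₂ + x₁₄) (x₁ + x₂ + x₃ + x₄ + x₅ + x₆ + x₈ + x₉ + x₁₀ + x₁₁) (x₁ + x₃ + x₄ + x₆ + x₇ + x₁₀ + x₁₄) (x₁ + x₂ + x₄ + x₅ + x₆ + x₉ + x₁₁) (x₁ + x₄ + x₆ + x₇ + x₁₄) (x₁ + x₃ + x₄ + x₆ + x₁₀) (x₁ + x₄ + x₆) := rfl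

/-- Bridge (by `rfl`): the reflected row `H_y_b_ac_ac` denotes its tree form. -/
theorem e_H_y_b_ac_ac_denote (x₁ x₂ x₃ x₄ x₅ x₆ x₇ x₈ x₉ x₁₀ x₁₁ x₁₂ x₁₃ x₁₄ x₁₅ : R) : (e_H_y_b_ac_ac).denote (ctx15 x₁ x₂ x₃ x₄ x₅ x₆ x₇ x₈ x₉ x₁₀ x₁₁ x₁₂ x₁₃ x₁₄ x₁₅) = E3h (x₁ + x₂ + x₃ + x₄ + x₅ + x₆ + x₇ + x₈ + x₉ + x₁₀ + x₁₁ + x₁₂ + x₁₃ + x₁₄ + x₁₅) (x₁ + x₂ + x₄ + x₅ + x₆ + x₇ + x₉ + x₁₁ + x₁₂ + x₁₄) (x₁ + x₂ + x₃ + x₅ + x₆ + x₁₀ + x₁₁) (x₁ + x₃ + x₄ + x₆ + x₇ + x₁₀ + x₁₄) (x₁ + x₂ + x₅ + x₆ + x₁₁) (x₁ + x₄ + x₆ + x₇ + x₁₄) (x₁ + x₃ + x₆ + x₁₀) (x₁ + x₆) := rfl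

/-- Bridge (by `rfl`): the reflected row `H_y_c_a_ab` denotes its tree form. -/
theorem e_H_y_c_a_ab_denote (x₁ x₂ x₃ x₄ x₅ x₆ x₇ x₈ x₉ x₁₀ x₁₁ x₁₂ x₁₃ x₁₄ x₁₅ : R) : (e_H_y_c_a_ab).denote (ctx15 x₁ x₂ x₃ x₄ x₅ x₆ x₇ x₈ x₉ x₁₀ x₁₁ x₁₂ x₁₃ x₁₄ x₁₅) = E3h (x₁ + x₂ + x₃ + x₄ + x₅ + x₆ + x₇ + x₈ + x₉ + x₁₀ + x₁₁ + x₁₂ + x₁₃ + x₁₄ + x₁₅) (x₁ + x₃ + x₄ + x₅ + x₆ + x₇ + x₉ + x₁₀ + x₁₃ + x₁₄) (x₁ + x₂ + x₃ + x₄ + x₅ + x₇ + x₈ + x₉ + x₁₂ + x₁₃) (x₁ + x₂ + x₄ + x₆ + x₇ + x₁₂ + x₁₄) (x₁ + x₃ + x₄ + x₅ + x₇ + x₉ + x₁₃) (x₁ + x₄ + x₆ + x₇ + x₁₄) (x₁ + x₂ + x₄ + x₇ + x₁₂) (x₁ + x₄ + x₇) := rfl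

/-- Bridge (by `rfl`) for the lower-bound form of `M`. -/
theorem eSq_denote (x₁ x₂ x₃ x₄ x₅ x₆ x₇ x₈ x₉ x₁₀ x₁₁ x₁₂ x₁₃ x₁₄ x₁₅ : R) : eSq.denote (ctx15 x₁ x₂ x₃ x₄ x₅ x₆ x₇ x₈ x₉ x₁₀ x₁₁ x₁₂ x₁₃ x₁₄ x₁₅) = x₃ ^ 2 + x₄ ^ 2 + x₇ ^ 2 + x₈ ^ 2 + x₉ ^ 2 + x₁₀ ^ 2 + x₁₂ ^ 2 + x₁₃ ^ 2 + x₁₄ ^ 2 + x₁₅ ^ 2 := rfl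

end Bridges

/-- Left side `M · polL₁` as a packed polynomial. -/
noncomputable def lhsT : PPoly := applyT pM (toPP L1FullCert.eL1)

/-- Right side `Σ_r (mA_r + (x₃−x₂)·mB_r)·g_r + cA + (x₃−x₂)·cB` as a packed polynomial (balanced merges). -/
noncomputable def rhsT : PPoly :=
  (mergeP (mergeP (mergeP (mergeP (mergeP (applyT mA_Fabc (toPP L1FullCert.e_Fabc)) (applyT mB_Fabc (rhoP 2 1 (toPP L1FullCert.e_Fabc)))) (mergeP (applyT mA_Faby (toPP e_Faby)) (applyT mA_H_b_a_cy_cy (toPP e_H_b_a_cy_cy)))) (mergeP (mergeP (applyT mB_H_c_a_by_by (rhoP 2 1 (toPP e_H_c_a_by_by))) (applyT mA_Fbcy (toPP e_Fbcy))) (mergeP (applyT mA_E3g (toPP L1FullCert.e_E3g)) (applyT mB_E3g (rhoP 2 1 (toPP L1FullCert.e_E3g)))))) (mergeP (mergeP (mergeP (applyT mB_H_y_b_a_ac (rhoP 2 1 (toPP e_H_y_b_a_ac))) (applyT mA_H_y_b_ac_ac (toPP e_H_y_b_ac_ac))) (mergeP (applyT mA_E1 (toPP L1FullCert.e_E1))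 (applyT mB_E1 (rhoP 2 1 (toPP L1FullCert.e_E1))))) (mergeP (mergeP (applyT mA_H_y_c_a_ab (toPP e_H_y_c_a_ab)) (applyT mA_Fe (toPP L1FullCert.e_Fe))) (mergeP (applyT mA_AGabc (toPP L1FullCert.e_AGabc)) (applyT mB_AGabc (rhoP 2 1 (toPP L1FullCert.e_AGabc))))))) (mergeP (mergeP (mergeP (mergeP (applyT mA_AGaby (toPP L1FullCert.e_AGaby)) (applyT mB_AGaby (rhoP 2 1 (toPP L1FullCert.e_AGaby)))) (mergeP (applyT mA_AGacy (toPP L1FullCert.e_AGacy)) (applyT mB_AGacy (rhoP 2 1 (toPP L1FullCert.e_AGacy))))) (mergeP (mergeP (applyT mA_AGbcy (toPP L1FullCert.e_AGbcy)) (applyT mB_AGbcy (rhoP 2 1 (toPP L1FullCert.e_AGbcy)))) (mergeP (applyT mA_AGe (toPP L1FullCert.e_AGe)) (applyT mB_AGe (rhoP 2 1 (toPP L1FullCert.e_AGe)))))) (mergeP (applyT cA (constP 1)) (rhoP 2 1 (applyT cB (constP 1))))))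

set_option maxHeartbeats 0 in
/-- **Kernel check of the certificate identity** `M·polL₁ = Σ_r m_r·g_r + C` (exact integers; ≈ 153 000 monomial products). -/
theorem check : subCheckP lhsT rhsT = true := by
  decide +kernel

/-- Kernel check: `1·M − Σ_{i∉S} xᵢ²` has nonnegative coefficients. -/
theorem checkM : coeffsP (mergeP (smulP 1 1 (applyT pM (constP 1))) (smulP (-1) 1 (toPP eSq))) = true := by
  decide +kernel

/-- Kernel check: every multiplier has nonnegative coefficients. -/
theorem nn_all : coeffsT pM = true ∧ coeffsT mA_Fabc = true ∧ coeffsT mA_Faby = true ∧ coeffsT mA_H_b_a_cy_cy = true ∧ coeffsT mA_Fbcy = true ∧ coeffsT mA_E3g = true ∧ coeffsT mA_H_y_b_ac_ac = true ∧ coeffsT mA_E1 = true ∧ coeffsT mA_H_y_c_a_ab = true ∧ coeffsT mA_Fe = true ∧ coeffsT mA_AGabc = true ∧ coeffsT mA_AGaby = true ∧ coeffsT mA_AGacy = true ∧ coeffsT mA_AGbcy = true ∧ coeffsT mA_AGe = true ∧ coeffsT mB_Fabc = true ∧ coeffsT mB_H_c_a_by_by = true ∧ coeffsT mB_E3g =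 true ∧ coeffsT mB_H_y_b_a_ac = true ∧ coeffsT mB_E1 = true ∧ coeffsT mB_AGabc = true ∧ coeffsT mB_AGaby = true ∧ coeffsT mB_AGacy = true ∧ coeffsT mB_AGbcy = true ∧ coeffsT mB_AGe = true ∧ coeffsT cA = true ∧ coeffsT cB = true := by
  decide +kernel

section Identity

variable {R : Type*} [CommRing R]

/-- **The certificate identity** `M·polL₁ = Σ_r (mA_r + (x₃−x₂)·mB_r)·g_r + cA + (x₃−x₂)·cB` over any commutative ring; the multipliers
are the explicit nonnegative-coefficient polynomials of the data file, denoted through `MTree.denote`. -/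
theorem identity (x₁ x₂ x₃ x₄ x₅ x₆ x₇ x₈ x₉ x₁₀ x₁₁ x₁₂ x₁₃ x₁₄ x₁₅ : R) :
    pM.denote (ctx15 x₁ x₂ x₃ x₄ x₅ x₆ x₇ x₈ x₉ x₁₀ x₁₁ x₁₂ x₁₃ x₁₄ x₁₅) * polL₁ x₁ x₂ x₃ x₄ x₅ x₆ x₇ x₈ x₉ x₁₀ x₁₁ x₁₂ x₁₃ x₁₄ x₁₅
      = mA_Fabc.denote (ctx15 x₁ x₂ x₃ x₄ x₅ x₆ x₇ x₈ x₉ x₁₀ x₁₁ x₁₂ x₁₃ x₁₄ x₁₅) * (CubicThreePointStep.F (x₁ + x₂ + x₃ + x₅) (x₇ + x₁₂ + x₁₃) (x₆ + x₁₀ + x₁₁) (x₄ + x₈ + x₉) (x₁₄ + x₁₅))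
        + mB_Fabc.denote (ctx15 x₁ x₂ x₃ x₄ x₅ x₆ x₇ x₈ x₉ x₁₀ x₁₁ x₁₂ x₁₃ x₁₄ x₁₅) * ((x₃ - x₂) * (CubicThreePointStep.F (x₁ + x₂ + x₃ + x₅) (x₇ + x₁₂ + x₁₃) (x₆ + x₁₀ + x₁₁) (x₄ + x₈ + x₉) (x₁₄ + x₁₅)))
        + mA_Faby.denote (ctx15 x₁ x₂ x₃ x₄ x₅ x₆ x₇ x₈ x₉ x₁₀ x₁₁ x₁₂ x₁₃ x₁₄ x₁₅) * (CubicThreePointStep.F (x₁ + x₂ + x₄ + x₆) (x₇ + x₁₂ + x₁₄) (x₅ + x₉ + x₁₁) (x₃ + x₈ + x₁₀) (x₁₃ + x₁₅))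
        + mA_H_b_a_cy_cy.denote (ctx15 x₁ x₂ x₃ x₄ x₅ x₆ x₇ x₈ x₉ x₁₀ x₁₁ x₁₂ x₁₃ x₁₄ x₁₅) * (E3h (x₁ + x₂ + x₃ + x₄ + x₅ + x₆ + x₇ + x₈ + x₉ + x₁₀ + x₁₁ + x₁₂ + x₁₃ + x₁₄ + x₁₅) (x₁ + x₂ + x₃ + x₄ + x₅ + x₆ + x₈ + x₉ + x₁₀ + x₁₁) (x₁ + x₂ + x₃ + x₄ + x₇ + x₈ + x₁₂) (x₁ + x₂ + x₅ + x₆ + x₇ + x₁₁ + x₁₂) (x₁ + x₂ + x₃ + x₄ + x₈) (x₁ + x₂ + x₅ + x₆ + x₁₁) (x₁ + x₂ + x₇ + x₁₂) (x₁ + x₂))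
        + mB_H_c_a_by_by.denote (ctx15 x₁ x₂ x₃ x₄ x₅ x₆ x₇ x₈ x₉ x₁₀ x₁₁ x₁₂ x₁₃ x₁₄ x₁₅) * ((x₃ - x₂) * (E3h (x₁ + x₂ + x₃ + x₄ + x₅ + x₆ + x₇ + x₈ + x₉ + x₁₀ + x₁₁ + x₁₂ + x₁₃ + x₁₄ + x₁₅) (x₁ + x₂ + x₃ + x₄ + x₅ + x₇ + x₈ + x₉ + x₁₂ + x₁₃) (x₁ + x₂ + x₃ + x₄ + x₆ + x₈ + x₁₀) (x₁ + x₃ + x₅ + x₆ + x₇ + x₁₀ + x₁₃) (x₁ + x₂ + x₃ + x₄ + x₈) (x₁ + x₃ + x₅ + x₇ + x₁₃) (x₁ + x₃ + x₆ + x₁₀) (x₁ + x₃)))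
        + mA_Fbcy.denote (ctx15 x₁ x₂ x₃ x₄ x₅ x₆ x₇ x₈ x₉ x₁₀ x₁₁ x₁₂ x₁₃ x₁₄ x₁₅) * (CubicThreePointStep.F (x₁ + x₅ + x₆ + x₇) (x₄ + x₉ + x₁₄) (x₃ + x₁₀ + x₁₃) (x₂ + x₁₁ + x₁₂) (x₈ + x₁₅))
        + mA_E3g.denote (ctx15 x₁ x₂ x₃ x₄ x₅ x₆ x₇ x₈ x₉ x₁₀ x₁₁ x₁₂ x₁₃ x₁₄ x₁₅) * (hybE₃g x₁ x₂ x₃ x₄ x₅ x₆ x₇ x₈ x₉ x₁₀ x₁₁ x₁₂ x₁₃ x₁₄ x₁₅)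
        + mB_E3g.denote (ctx15 x₁ x₂ x₃ x₄ x₅ x₆ x₇ x₈ x₉ x₁₀ x₁₁ x₁₂ x₁₃ x₁₄ x₁₅) * ((x₃ - x₂) * (hybE₃g x₁ x₂ x₃ x₄ x₅ x₆ x₇ x₈ x₉ x₁₀ x₁₁ x₁₂ x₁₃ x₁₄ x₁₅))
        + mB_H_y_b_a_ac.denote (ctx15 x₁ x₂ x₃ x₄ x₅ x₆ x₇ x₈ x₉ x₁₀ x₁₁ x₁₂ x₁₃ x₁₄ x₁₅) * ((x₃ - x₂) * (E3h (x₁ + x₂ + x₃ + x₄ + x₅ + x₆ + x₇ + x₈ + x₉ + x₁₀ + x₁₁ + x₁₂ + x₁₃ + x₁₄ + x₁₅) (x₁ + x₂ + x₄ + x₅ + x₆ + x₇ + x₉ + x₁₁ + x₁₂ + x₁₄) (x₁ + x₂ + x₃ + x₄ + x₅ + x₆ + x₈ + x₉ + x₁₀ + x₁₁) (x₁ + x₃ + x₄ + x₆ + x₇ + x₁₀ + x₁₄) (x₁ + x₂ + x₄ + x₅ + x₆ + x₉ + x₁₁) (x₁ + x₄ + x₆ + x₇ + x₁₄) (x₁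 + x₃ + x₄ + x₆ + x₁₀) (x₁ + x₄ + x₆)))
        + mA_H_y_b_ac_ac.denote (ctx15 x₁ x₂ x₃ x₄ x₅ x₆ x₇ x₈ x₉ x₁₀ x₁₁ x₁₂ x₁₃ x₁₄ x₁₅) * (E3h (x₁ + x₂ + x₃ + x₄ + x₅ + x₆ + x₇ + x₈ + x₉ + x₁₀ + x₁₁ + x₁₂ + x₁₃ + x₁₄ + x₁₅) (x₁ + x₂ + x₄ + x₅ + x₆ + x₇ + x₉ + x₁₁ + x₁₂ + x₁₄) (x₁ + x₂ + x₃ + x₅ + x₆ + x₁₀ + x₁₁) (x₁ + x₃ + x₄ + x₆ + x₇ + x₁₀ + x₁₄) (x₁ + x₂ + x₅ + x₆ + x₁₁) (x₁ + x₄ + x₆ + x₇ + x₁₄) (x₁ + x₃ + x₆ + x₁₀) (x₁ + x₆))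
        + mA_E1.denote (ctx15 x₁ x₂ x₃ x₄ x₅ x₆ x₇ x₈ x₉ x₁₀ x₁₁ x₁₂ x₁₃ x₁₄ x₁₅) * (hybE₁ x₁ x₂ x₃ x₄ x₅ x₆ x₇ x₈ x₉ x₁₀ x₁₁ x₁₂ x₁₃ x₁₄ x₁₅)
        + mB_E1.denote (ctx15 x₁ x₂ x₃ x₄ x₅ x₆ x₇ x₈ x₉ x₁₀ x₁₁ x₁₂ x₁₃ x₁₄ x₁₅) * ((x₃ - x₂) * (hybE₁ x₁ x₂ x₃ x₄ x₅ x₆ x₇ x₈ x₉ x₁₀ x₁₁ x₁₂ x₁₃ x₁₄ x₁₅))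
        + mA_H_y_c_a_ab.denote (ctx15 x₁ x₂ x₃ x₄ x₅ x₆ x₇ x₈ x₉ x₁₀ x₁₁ x₁₂ x₁₃ x₁₄ x₁₅) * (E3h (x₁ + x₂ + x₃ + x₄ + x₅ + x₆ + x₇ + x₈ + x₉ + x₁₀ + x₁₁ + x₁₂ + x₁₃ + x₁₄ + x₁₅) (x₁ + x₃ + x₄ + x₅ + x₆ + x₇ + x₉ + x₁₀ + x₁₃ + x₁₄) (x₁ + x₂ + x₃ + x₄ + x₅ + x₇ + x₈ + x₉ + x₁₂ + x₁₃) (x₁ + x₂ + x₄ + x₆ + x₇ + x₁₂ + x₁₄) (x₁ + x₃ + x₄ + x₅ + x₇ + x₉ + x₁₃) (x₁ + x₄ + x₆ + x₇ + x₁₄) (x₁ + x₂ + x₄ + x₇ + x₁₂) (x₁ + x₄ + x₇))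
        + mA_Fe.denote (ctx15 x₁ x₂ x₃ x₄ x₅ x₆ x₇ x₈ x₉ x₁₀ x₁₁ x₁₂ x₁₃ x₁₄ x₁₅) * (CubicThreePointStep.F (x₁ + x₅) (x₃ + x₇ + x₁₃) (x₂ + x₆ + x₁₁) (x₄ + x₉) (x₈ + x₁₀ + x₁₂ + x₁₄ + x₁₅))
        + mA_AGabc.denote (ctx15 x₁ x₂ x₃ x₄ x₅ x₆ x₇ x₈ x₉ x₁₀ x₁₁ x₁₂ x₁₃ x₁₄ x₁₅) * ((x₁ + x₂ + x₃ + x₅) * (x₁₄ + x₁₅) - ((x₇ + x₁₂ + x₁₃) * (x₆ + x₁₀ + x₁₁) + (x₇ + x₁₂ + x₁₃) * (x₄ + x₈ + x₉) + (x₆ + x₁₀ + x₁₁) * (x₄ + x₈ + x₉)))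
        + mB_AGabc.denote (ctx15 x₁ x₂ x₃ x₄ x₅ x₆ x₇ x₈ x₉ x₁₀ x₁₁ x₁₂ x₁₃ x₁₄ x₁₅) * ((x₃ - x₂) * ((x₁ + x₂ + x₃ + x₅) * (x₁₄ + x₁₅) - ((x₇ + x₁₂ + x₁₃) * (x₆ + x₁₀ + x₁₁) + (x₇ + x₁₂ + x₁₃) * (x₄ + x₈ + x₉) + (x₆ + x₁₀ + x₁₁) * (x₄ + x₈ + x₉))))
        + mA_AGaby.denote (ctx15 x₁ x₂ x₃ x₄ x₅ x₆ x₇ x₈ x₉ x₁₀ x₁₁ x₁₂ x₁₃ x₁₄ x₁₅) * ((x₁ + x₂ + x₄ + x₆) * (x₁₃ + x₁₅) - ((x₇ + x₁₂ + x₁₄) * (x₅ + x₉ + x₁₁) + (x₇ + x₁₂ + x₁₄) * (x₃ + x₈ + x₁₀) + (x₅ + x₉ + x₁₁) * (x₃ + x₈ + x₁₀)))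
        + mB_AGaby.denote (ctx15 x₁ x₂ x₃ x₄ x₅ x₆ x₇ x₈ x₉ x₁₀ x₁₁ x₁₂ x₁₃ x₁₄ x₁₅) * ((x₃ - x₂) * ((x₁ + x₂ + x₄ + x₆) * (x₁₃ + x₁₅) - ((x₇ + x₁₂ + x₁₄) * (x₅ + x₉ + x₁₁) + (x₇ + x₁₂ + x₁₄) * (x₃ + x₈ + x₁₀) + (x₅ + x₉ + x₁₁) * (x₃ + x₈ + x₁₀))))
        + mA_AGacy.denote (ctx15 x₁ x₂ x₃ x₄ x₅ x₆ x₇ x₈ x₉ x₁₀ x₁₁ x₁₂ x₁₃ x₁₄ x₁₅) * ((x₁ + x₃ + x₄ + x₇) * (x₁₁ + x₁₅) - ((x₆ + x₁₀ + x₁₄) * (x₅ + x₉ + x₁₃) + (x₆ + x₁₀ + x₁₄) * (x₂ + x₈ + x₁₂) + (x₅ + x₉ + x₁₃) * (x₂ + x₈ + x₁₂)))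
        + mB_AGacy.denote (ctx15 x₁ x₂ x₃ x₄ x₅ x₆ x₇ x₈ x₉ x₁₀ x₁₁ x₁₂ x₁₃ x₁₄ x₁₅) * ((x₃ - x₂) * ((x₁ + x₃ + x₄ + x₇) * (x₁₁ + x₁₅) - ((x₆ + x₁₀ + x₁₄) * (x₅ + x₉ + x₁₃) + (x₆ + x₁₀ + x₁₄) * (x₂ + x₈ + x₁₂) + (x₅ + x₉ + x₁₃) * (x₂ + x₈ + x₁₂))))
        + mA_AGbcy.denote (ctx15 x₁ x₂ x₃ x₄ x₅ x₆ x₇ x₈ x₉ x₁₀ x₁₁ x₁₂ x₁₃ x₁₄ x₁₅) * ((x₁ + x₅ + x₆ + x₇) * (x₈ + x₁₅) - ((x₄ + x₉ + x₁₄) * (x₃ + x₁₀ + x₁₃) + (x₄ + x₉ + x₁₄) * (x₂ + x₁₁ + x₁₂) + (x₃ + x₁₀ + x₁₃) * (x₂ + x₁₁ + x₁₂)))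
        + mB_AGbcy.denote (ctx15 x₁ x₂ x₃ x₄ x₅ x₆ x₇ x₈ x₉ x₁₀ x₁₁ x₁₂ x₁₃ x₁₄ x₁₅) * ((x₃ - x₂) * ((x₁ + x₅ + x₆ + x₇) * (x₈ + x₁₅) - ((x₄ + x₉ + x₁₄) * (x₃ + x₁₀ + x₁₃) + (x₄ + x₉ + x₁₄) * (x₂ + x₁₁ + x₁₂) + (x₃ + x₁₀ + x₁₃) * (x₂ + x₁₁ + x₁₂))))
        + mA_AGe.denote (ctx15 x₁ x₂ x₃ x₄ x₅ x₆ x₇ x₈ x₉ x₁₀ x₁₁ x₁₂ x₁₃ x₁₄ x₁₅) * ((x₁ + x₅) * (x₈ + x₁₀ + x₁₂ + x₁₄ + x₁₅) - ((x₃ + x₇ + x₁₃) * (x₂ + x₆ + x₁₁) + (x₃ + x₇ + x₁₃) * (x₄ + x₉) + (x₂ + x₆ + x₁₁) * (x₄ + x₉)))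
        + mB_AGe.denote (ctx15 x₁ x₂ x₃ x₄ x₅ x₆ x₇ x₈ x₉ x₁₀ x₁₁ x₁₂ x₁₃ x₁₄ x₁₅) * ((x₃ - x₂) * ((x₁ + x₅) * (x₈ + x₁₀ + x₁₂ + x₁₄ + x₁₅) - ((x₃ + x₇ + x₁₃) * (x₂ + x₆ + x₁₁) + (x₃ + x₇ + x₁₃) * (x₄ + x₉) + (x₂ + x₆ + x₁₁) * (x₄ + x₉))))
        + cA.denote (ctx15 x₁ x₂ x₃ x₄ x₅ x₆ x₇ x₈ x₉ x₁₀ x₁₁ x₁₂ x₁₃ x₁₄ x₁₅)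
        + (x₃ - x₂) * cB.denote (ctx15 x₁ x₂ x₃ x₄ x₅ x₆ x₇ x₈ x₉ x₁₀ x₁₁ x₁₂ x₁₃ x₁₄ x₁₅) := by
  have h := denote_eq_of_subCheckP (ctx15 x₁ x₂ x₃ x₄ x₅ x₆ x₇ x₈ x₉ x₁₀ x₁₁ x₁₂ x₁₃ x₁₄ x₁₅) lhsT rhsT check
  have hw := wf_all
  have g1 : (ctx15 x₁ x₂ x₃ x₄ x₅ x₆ x₇ x₈ x₉ x₁₀ x₁₁ x₁₂ x₁₃ x₁₄ x₁₅).get 1 = x₂ := rfl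
  have g2 : (ctx15 x₁ x₂ x₃ x₄ x₅ x₆ x₇ x₈ x₉ x₁₀ x₁₁ x₁₂ x₁₃ x₁₄ x₁₅).get 2 = x₃ := rfl
  simp only [lhsT, rhsT, denote_applyT, denote_mergeP, denote_rhoP _ 2 1 (by decide) (by decide), denote_constP, mul_one,
    denote_toPP _ L1FullCert.eL1 hw.1, denote_toPP _ L1FullCert.e_Fabc hw.2.1, denote_toPP _ e_Faby hw.2.2.1, denote_toPP _ e_H_b_a_cy_cy hw.2.2.2.1, denote_toPP _ e_H_c_a_by_by hw.2.2.2.2.1, denote_toPP _ e_Fbcy hw.2.2.2.2.2.1, denote_toPP _ L1FullCert.e_E3g hw.2.2.2.2.2.2.1, denote_toPP _ e_H_y_b_a_ac hw.2.2.2.2.2.2.2.1, denote_toPP _ e_H_y_b_ac_ac hw.2.2.2.2.2.2.2.2.1, denote_toPP _ L1FullCert.e_E1 hw.2.2.2.2.2.2.2.2.2.1, denote_toPP _ e_H_y_c_a_ab hw.2.2.2.2.2.2.2.2.2.2.1, denote_toPP _ L1FullCert.e_Fe hw.2.2.2.2.2.2.2.2.2.2.2.1, denote_toPP _ L1FullCert.e_AGabc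 hw.2.2.2.2.2.2.2.2.2.2.2.2.1, denote_toPP _ L1FullCert.e_AGaby hw.2.2.2.2.2.2.2.2.2.2.2.2.2.1, denote_toPP _ L1FullCert.e_AGacy hw.2.2.2.2.2.2.2.2.2.2.2.2.2.2.1, denote_toPP _ L1FullCert.e_AGbcy hw.2.2.2.2.2.2.2.2.2.2.2.2.2.2.2.1, denote_toPP _ L1FullCert.e_AGe hw.2.2.2.2.2.2.2.2.2.2.2.2.2.2.2.2.1,
    L1FullCert.eL1_denote, L1FullCert.e_Fabc_denote, e_Faby_denote, e_H_b_a_cy_cy_denote, e_H_c_a_by_by_denote, e_Fbcy_denote, L1FullCert.e_E3g_denote, e_H_y_b_a_ac_denote, e_H_y_b_ac_ac_denote, L1FullCert.e_E1_denote, e_H_y_c_a_ab_denote, L1FullCert.e_Fe_denote, L1FullCert.e_AGabc_denote, L1FullCert.e_AGaby_denote, L1FullCert.e_AGacy_denote, L1FullCert.e_AGbcy_denote, L1FullCert.e_AGe_denote, Int.cast_one, g1, g2] at h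
  linear_combination h

end Identity

/-- **(L1) on the region `x₂ ≤ x₃` (`a|b|cy ≤ a|by|c`) from THEOREM rows.**  For nonnegative cells: if the five Aas–Gladkov rows (four marginals
and the quotient `a = y`) and the eleven hybrid three-point rows (`E3h …` instances of `HybridThreePointLB`, incl. `hybE₁` and the quotient
instance `hybE₃g`) are nonnegative — all of them tree theorems on realizable laws — then `0 ≤ polL₁`. -/
theorem polL₁_nonneg_regionA {x₁ x₂ x₃ x₄ x₅ x₆ x₇ x₈ x₉ x₁₀ x₁₁ x₁₂ x₁₃ x₁₄ x₁₅ : ℝ}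
    (h₁ : 0 ≤ x₁) (h₂ : 0 ≤ x₂) (h₃ : 0 ≤ x₃) (h₄ : 0 ≤ x₄) (h₅ : 0 ≤ x₅) (h₆ : 0 ≤ x₆) (h₇ : 0 ≤ x₇) (h₈ : 0 ≤ x₈) (h₉ : 0 ≤ x₉) (h₁₀ : 0 ≤ x₁₀) (h₁₁ : 0 ≤ x₁₁) (h₁₂ : 0 ≤ x₁₂) (h₁₃ : 0 ≤ x₁₃) (h₁₄ : 0 ≤ x₁₄) (h₁₅ : 0 ≤ x₁₅)
    (hreg : x₂ ≤ x₃)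
    (hFabc : 0 ≤ CubicThreePointStep.F (x₁ + x₂ + x₃ + x₅) (x₇ + x₁₂ + x₁₃) (x₆ + x₁₀ + x₁₁) (x₄ + x₈ + x₉) (x₁₄ + x₁₅))
    (hFaby : 0 ≤ CubicThreePointStep.F (x₁ + x₂ + x₄ + x₆) (x₇ + x₁₂ + x₁₄) (x₅ + x₉ + x₁₁) (x₃ + x₈ + x₁₀) (x₁₃ + x₁₅))
    (hH_b_a_cy_cy : 0 ≤ E3h (x₁ + x₂ + x₃ + x₄ + x₅ + x₆ + x₇ + x₈ + x₉ + x₁₀ + x₁₁ + x₁₂ + x₁₃ + x₁₄ + x₁₅) (x₁ + x₂ + x₃ + x₄ + x₅ + x₆ + x₈ + x₉ + x₁₀ + x₁₁) (x₁ + x₂ + x₃ + x₄ + x₇ + x₈ + x₁₂) (x₁ + x₂ + x₅ + x₆ + x₇ + x₁₁ + x₁₂) (x₁ + x₂ + x₃ + x₄ + x₈) (x₁ + x₂ + x₅ + x₆ + x₁₁) (x₁ + x₂ + x₇ + x₁₂) (x₁ + x₂))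
    (hH_c_a_by_by : 0 ≤ E3h (x₁ + x₂ + x₃ + x₄ + x₅ + x₆ + x₇ + x₈ + x₉ + x₁₀ + x₁₁ + x₁₂ + x₁₃ + x₁₄ + x₁₅) (x₁ + x₂ + x₃ + x₄ + x₅ + x₇ + x₈ + x₉ + x₁₂ + x₁₃) (x₁ + x₂ + x₃ + x₄ + x₆ + x₈ + x₁₀) (x₁ + x₃ + x₅ + x₆ + x₇ + x₁₀ + x₁₃) (x₁ + x₂ + x₃ + x₄ + x₈) (x₁ + x₃ + x₅ + x₇ + x₁₃) (x₁ + x₃ + x₆ + x₁₀) (x₁ + x₃))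
    (hFbcy : 0 ≤ CubicThreePointStep.F (x₁ + x₅ + x₆ + x₇) (x₄ + x₉ + x₁₄) (x₃ + x₁₀ + x₁₃) (x₂ + x₁₁ + x₁₂) (x₈ + x₁₅))
    (hE3g : 0 ≤ hybE₃g x₁ x₂ x₃ x₄ x₅ x₆ x₇ x₈ x₉ x₁₀ x₁₁ x₁₂ x₁₃ x₁₄ x₁₅)
    (hH_y_b_a_ac : 0 ≤ E3h (x₁ + x₂ + x₃ + x₄ + x₅ + x₆ + x₇ + x₈ + x₉ + x₁₀ + x₁₁ + x₁₂ + x₁₃ + x₁₄ + x₁₅) (x₁ + x₂ + x₄ + x₅ + x₆ + x₇ + x₉ + x₁₁ + x₁₂ + x₁₄) (x₁ + x₂ + x₃ + x₄ + x₅ + x₆ + x₈ + x₉ + x₁₀ + x₁₁) (x₁ + x₃ + x₄ + x₆ + x₇ + x₁₀ + x₁₄) (x₁ + x₂ + x₄ + x₅ + x₆ + x₉ + x₁₁) (x₁ + x₄ + x₆ + x₇ + x₁₄) (x₁ + x₃ + x₄ + x₆ + x₁₀) (x₁ + x₄ + x₆))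
    (hH_y_b_ac_ac : 0 ≤ E3h (x₁ + x₂ + x₃ + x₄ + x₅ + x₆ + x₇ + x₈ + x₉ + x₁₀ + x₁₁ + x₁₂ + x₁₃ + x₁₄ + x₁₅) (x₁ + x₂ + x₄ + x₅ + x₆ + x₇ + x₉ + x₁₁ + x₁₂ + x₁₄) (x₁ + x₂ + x₃ + x₅ + x₆ + x₁₀ + x₁₁) (x₁ + x₃ + x₄ + x₆ + x₇ + x₁₀ + x₁₄) (x₁ + x₂ + x₅ + x₆ + x₁₁) (x₁ + x₄ + x₆ + x₇ + x₁₄) (x₁ + x₃ + x₆ + x₁₀) (x₁ + x₆))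
    (hE1 : 0 ≤ hybE₁ x₁ x₂ x₃ x₄ x₅ x₆ x₇ x₈ x₉ x₁₀ x₁₁ x₁₂ x₁₃ x₁₄ x₁₅)
    (hH_y_c_a_ab : 0 ≤ E3h (x₁ + x₂ + x₃ + x₄ + x₅ + x₆ + x₇ + x₈ + x₉ + x₁₀ + x₁₁ + x₁₂ + x₁₃ + x₁₄ + x₁₅) (x₁ + x₃ + x₄ + x₅ + x₆ + x₇ + x₉ + x₁₀ + x₁₃ + x₁₄) (x₁ + x₂ + x₃ + x₄ + x₅ + x₇ + x₈ + x₉ + x₁₂ + x₁₃) (x₁ + x₂ + x₄ + x₆ + x₇ + x₁₂ + x₁₄) (x₁ + x₃ + x₄ + x₅ + x₇ + x₉ + x₁₃) (x₁ + x₄ + x₆ + x₇ + x₁₄) (x₁ + x₂ + x₄ + x₇ + x₁₂) (x₁ + x₄ + x₇))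
    (hFe : 0 ≤ CubicThreePointStep.F (x₁ + x₅) (x₃ + x₇ + x₁₃) (x₂ + x₆ + x₁₁) (x₄ + x₉) (x₈ + x₁₀ + x₁₂ + x₁₄ + x₁₅))
    (hAGabc : 0 ≤ (x₁ + x₂ + x₃ + x₅) * (x₁₄ + x₁₅) - ((x₇ + x₁₂ + x₁₃) * (x₆ + x₁₀ + x₁₁) + (x₇ + x₁₂ + x₁₃) * (x₄ + x₈ + x₉) + (x₆ + x₁₀ + x₁₁) * (x₄ + x₈ + x₉)))
    (hAGaby : 0 ≤ (x₁ + x₂ + x₄ + x₆) * (x₁₃ + x₁₅) - ((x₇ + x₁₂ + x₁₄) * (x₅ + x₉ + x₁₁) + (x₇ + x₁₂ + x₁₄) * (x₃ + x₈ + x₁₀) + (x₅ + x₉ + x₁₁) * (x₃ + x₈ + x₁₀)))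
    (hAGacy : 0 ≤ (x₁ + x₃ + x₄ + x₇) * (x₁₁ + x₁₅) - ((x₆ + x₁₀ + x₁₄) * (x₅ + x₉ + x₁₃) + (x₆ + x₁₀ + x₁₄) * (x₂ + x₈ + x₁₂) + (x₅ + x₉ + x₁₃) * (x₂ + x₈ + x₁₂)))
    (hAGbcy : 0 ≤ (x₁ + x₅ + x₆ + x₇) * (x₈ + x₁₅) - ((x₄ + x₉ + x₁₄) * (x₃ + x₁₀ + x₁₃) + (x₄ + x₉ + x₁₄) * (x₂ + x₁₁ + x₁₂) + (x₃ + x₁₀ + x₁₃) * (x₂ + x₁₁ + x₁₂)))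
    (hAGe : 0 ≤ (x₁ + x₅) * (x₈ + x₁₀ + x₁₂ + x₁₄ + x₁₅) - ((x₃ + x₇ + x₁₃) * (x₂ + x₆ + x₁₁) + (x₃ + x₇ + x₁₃) * (x₄ + x₉) + (x₂ + x₆ + x₁₁) * (x₄ + x₉))) :
    0 ≤ polL₁ x₁ x₂ x₃ x₄ x₅ x₆ x₇ x₈ x₉ x₁₀ x₁₁ x₁₂ x₁₃ x₁₄ x₁₅ := by
  have hx := ctx15_get_nonneg (R := ℝ) h₁ h₂ h₃ h₄ h₅ h₆ h₇ h₈ h₉ h₁₀ h₁₁ h₁₂ h₁₃ h₁₄ h₁₅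
  have hid := identity x₁ x₂ x₃ x₄ x₅ x₆ x₇ x₈ x₉ x₁₀ x₁₁ x₁₂ x₁₃ x₁₄ x₁₅
  have hρ : (0:ℝ) ≤ x₃ - x₂ := sub_nonneg.mpr hreg
  have nn := nn_all
  have n_pM := MTree.denote_nonneg_of_coeffsT (ctx15 x₁ x₂ x₃ x₄ x₅ x₆ x₇ x₈ x₉ x₁₀ x₁₁ x₁₂ x₁₃ x₁₄ x₁₅) hx pM nn.1
  have n_mA_Fabc := MTree.denote_nonneg_of_coeffsT (ctx15 x₁ x₂ x₃ x₄ x₅ x₆ x₇ x₈ x₉ x₁₀ x₁₁ x₁₂ x₁₃ x₁₄ x₁₅) hx mA_Fabc nn.2.1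
  have n_mA_Faby := MTree.denote_nonneg_of_coeffsT (ctx15 x₁ x₂ x₃ x₄ x₅ x₆ x₇ x₈ x₉ x₁₀ x₁₁ x₁₂ x₁₃ x₁₄ x₁₅) hx mA_Faby nn.2.2.1
  have n_mA_H_b_a_cy_cy := MTree.denote_nonneg_of_coeffsT (ctx15 x₁ x₂ x₃ x₄ x₅ x₆ x₇ x₈ x₉ x₁₀ x₁₁ x₁₂ x₁₃ x₁₄ x₁₅) hx mA_H_b_a_cy_cy nn.2.2.2.1
  have n_mA_Fbcy := MTree.denote_nonneg_of_coeffsT (ctx15 x₁ x₂ x₃ x₄ x₅ x₆ x₇ x₈ x₉ x₁₀ x₁₁ x₁₂ x₁₃ x₁₄ x₁₅) hx mA_Fbcy nn.2.2.2.2.1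
  have n_mA_E3g := MTree.denote_nonneg_of_coeffsT (ctx15 x₁ x₂ x₃ x₄ x₅ x₆ x₇ x₈ x₉ x₁₀ x₁₁ x₁₂ x₁₃ x₁₄ x₁₅) hx mA_E3g nn.2.2.2.2.2.1
  have n_mA_H_y_b_ac_ac := MTree.denote_nonneg_of_coeffsT (ctx15 x₁ x₂ x₃ x₄ x₅ x₆ x₇ x₈ x₉ x₁₀ x₁₁ x₁₂ x₁₃ x₁₄ x₁₅) hx mA_H_y_b_ac_ac nn.2.2.2.2.2.2.1
  have n_mA_E1 := MTree.denote_nonneg_of_coeffsT (ctx15 x₁ x₂ x₃ x₄ x₅ x₆ x₇ x₈ x₉ x₁₀ x₁₁ x₁₂ x₁₃ x₁₄ x₁₅) hx mA_E1 nn.2.2.2.2.2.2.2.1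
  have n_mA_H_y_c_a_ab := MTree.denote_nonneg_of_coeffsT (ctx15 x₁ x₂ x₃ x₄ x₅ x₆ x₇ x₈ x₉ x₁₀ x₁₁ x₁₂ x₁₃ x₁₄ x₁₅) hx mA_H_y_c_a_ab nn.2.2.2.2.2.2.2.2.1
  have n_mA_Fe := MTree.denote_nonneg_of_coeffsT (ctx15 x₁ x₂ x₃ x₄ x₅ x₆ x₇ x₈ x₉ x₁₀ x₁₁ x₁₂ x₁₃ x₁₄ x₁₅) hx mA_Fe nn.2.2.2.2.2.2.2.2.2.1
  have n_mA_AGabc := MTree.denote_nonneg_of_coeffsT (ctx15 x₁ x₂ x₃ x₄ x₅ x₆ x₇ x₈ x₉ x₁₀ x₁₁ x₁₂ x₁₃ x₁₄ x₁₅) hx mA_AGabc nn.2.2.2.2.2.2.2.2.2.2.1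
  have n_mA_AGaby := MTree.denote_nonneg_of_coeffsT (ctx15 x₁ x₂ x₃ x₄ x₅ x₆ x₇ x₈ x₉ x₁₀ x₁₁ x₁₂ x₁₃ x₁₄ x₁₅) hx mA_AGaby nn.2.2.2.2.2.2.2.2.2.2.2.1
  have n_mA_AGacy := MTree.denote_nonneg_of_coeffsT (ctx15 x₁ x₂ x₃ x₄ x₅ x₆ x₇ x₈ x₉ x₁₀ x₁₁ x₁₂ x₁₃ x₁₄ x₁₅) hx mA_AGacy nn.2.2.2.2.2.2.2.2.2.2.2.2.1
  have n_mA_AGbcy := MTree.denote_nonneg_of_coeffsT (ctx15 x₁ x₂ x₃ x₄ x₅ x₆ x₇ x₈ x₉ x₁₀ x₁₁ x₁₂ x₁₃ x₁₄ x₁₅) hx mA_AGbcy nn.2.2.2.2.2.2.2.2.2.2.2.2.2.1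
  have n_mA_AGe := MTree.denote_nonneg_of_coeffsT (ctx15 x₁ x₂ x₃ x₄ x₅ x₆ x₇ x₈ x₉ x₁₀ x₁₁ x₁₂ x₁₃ x₁₄ x₁₅) hx mA_AGe nn.2.2.2.2.2.2.2.2.2.2.2.2.2.2.1
  have n_mB_Fabc := MTree.denote_nonneg_of_coeffsT (ctx15 x₁ x₂ x₃ x₄ x₅ x₆ x₇ x₈ x₉ x₁₀ x₁₁ x₁₂ x₁₃ x₁₄ x₁₅) hx mB_Fabc nn.2.2.2.2.2.2.2.2.2.2.2.2.2.2.2.1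
  have n_mB_H_c_a_by_by := MTree.denote_nonneg_of_coeffsT (ctx15 x₁ x₂ x₃ x₄ x₅ x₆ x₇ x₈ x₉ x₁₀ x₁₁ x₁₂ x₁₃ x₁₄ x₁₅) hx mB_H_c_a_by_by nn.2.2.2.2.2.2.2.2.2.2.2.2.2.2.2.2.1
  have n_mB_E3g := MTree.denote_nonneg_of_coeffsT (ctx15 x₁ x₂ x₃ x₄ x₅ x₆ x₇ x₈ x₉ x₁₀ x₁₁ x₁₂ x₁₃ x₁₄ x₁₅) hx mB_E3g nn.2.2.2.2.2.2.2.2.2.2.2.2.2.2.2.2.2.1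
  have n_mB_H_y_b_a_ac := MTree.denote_nonneg_of_coeffsT (ctx15 x₁ x₂ x₃ x₄ x₅ x₆ x₇ x₈ x₉ x₁₀ x₁₁ x₁₂ x₁₃ x₁₄ x₁₅) hx mB_H_y_b_a_ac nn.2.2.2.2.2.2.2.2.2.2.2.2.2.2.2.2.2.2.1
  have n_mB_E1 := MTree.denote_nonneg_of_coeffsT (ctx15 x₁ x₂ x₃ x₄ x₅ x₆ x₇ x₈ x₉ x₁₀ x₁₁ x₁₂ x₁₃ x₁₄ x₁₅) hx mB_E1 nn.2.2.2.2.2.2.2.2.2.2.2.2.2.2.2.2.2.2.2.1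
  have n_mB_AGabc := MTree.denote_nonneg_of_coeffsT (ctx15 x₁ x₂ x₃ x₄ x₅ x₆ x₇ x₈ x₉ x₁₀ x₁₁ x₁₂ x₁₃ x₁₄ x₁₅) hx mB_AGabc nn.2.2.2.2.2.2.2.2.2.2.2.2.2.2.2.2.2.2.2.2.1
  have n_mB_AGaby := MTree.denote_nonneg_of_coeffsT (ctx15 x₁ x₂ x₃ x₄ x₅ x₆ x₇ x₈ x₉ x₁₀ x₁₁ x₁₂ x₁₃ x₁₄ x₁₅) hx mB_AGaby nn.2.2.2.2.2.2.2.2.2.2.2.2.2.2.2.2.2.2.2.2.2.1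
  have n_mB_AGacy := MTree.denote_nonneg_of_coeffsT (ctx15 x₁ x₂ x₃ x₄ x₅ x₆ x₇ x₈ x₉ x₁₀ x₁₁ x₁₂ x₁₃ x₁₄ x₁₅) hx mB_AGacy nn.2.2.2.2.2.2.2.2.2.2.2.2.2.2.2.2.2.2.2.2.2.2.1
  have n_mB_AGbcy := MTree.denote_nonneg_of_coeffsT (ctx15 x₁ x₂ x₃ x₄ x₅ x₆ x₇ x₈ x₉ x₁₀ x₁₁ x₁₂ x₁₃ x₁₄ x₁₅) hx mB_AGbcy nn.2.2.2.2.2.2.2.2.2.2.2.2.2.2.2.2.2.2.2.2.2.2.2.1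
  have n_mB_AGe := MTree.denote_nonneg_of_coeffsT (ctx15 x₁ x₂ x₃ x₄ x₅ x₆ x₇ x₈ x₉ x₁₀ x₁₁ x₁₂ x₁₃ x₁₄ x₁₅) hx mB_AGe nn.2.2.2.2.2.2.2.2.2.2.2.2.2.2.2.2.2.2.2.2.2.2.2.2.1
  have n_cA := MTree.denote_nonneg_of_coeffsT (ctx15 x₁ x₂ x₃ x₄ x₅ x₆ x₇ x₈ x₉ x₁₀ x₁₁ x₁₂ x₁₃ x₁₄ x₁₅) hx cA nn.2.2.2.2.2.2.2.2.2.2.2.2.2.2.2.2.2.2.2.2.2.2.2.2.2.1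
  have n_cB := MTree.denote_nonneg_of_coeffsT (ctx15 x₁ x₂ x₃ x₄ x₅ x₆ x₇ x₈ x₉ x₁₀ x₁₁ x₁₂ x₁₃ x₁₄ x₁₅) hx cB nn.2.2.2.2.2.2.2.2.2.2.2.2.2.2.2.2.2.2.2.2.2.2.2.2.2.2
  have hR : 0 ≤ pM.denote (ctx15 x₁ x₂ x₃ x₄ x₅ x₆ x₇ x₈ x₉ x₁₀ x₁₁ x₁₂ x₁₃ x₁₄ x₁₅) * polL₁ x₁ x₂ x₃ x₄ x₅ x₆ x₇ x₈ x₉ x₁₀ x₁₁ x₁₂ x₁₃ x₁₄ x₁₅ := by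
    rw [hid]
    exact add_nonneg (add_nonneg (add_nonneg (add_nonneg (add_nonneg (add_nonneg (add_nonneg (add_nonneg (add_nonneg (add_nonneg (add_nonneg (add_nonneg (add_nonneg (add_nonneg (add_nonneg (add_nonneg (add_nonneg (add_nonneg (add_nonneg (add_nonneg (add_nonneg (add_nonneg (add_nonneg (add_nonneg (add_nonneg (mul_nonneg n_mA_Fabc hFabc) (mul_nonneg n_mB_Fabc (mul_nonneg hρ hFabc))) (mul_nonneg n_mA_Faby hFaby)) (mul_nonneg n_mA_H_b_a_cy_cy hH_b_a_cy_cy)) (mul_nonneg n_mB_H_c_a_by_by (mul_nonneg hρ hH_c_a_by_by))) (mul_nonneg n_mA_Fbcy hFbcy)) (mul_nonneg n_mA_E3g hE3g)) (mul_nonneg n_mB_E3g (mul_nonneg hρ hE3g))) (mul_nonneg n_mB_H_y_b_a_ac (mul_nonneg hρ hH_y_b_a_ac))) (mul_nonneg n_mA_H_y_b_ac_ac hH_y_b_ac_ac)) (mul_nonneg n_mA_E1 hE1)) (mul_nonneg n_mB_E1 (mul_nonneg hρ hE1))) (mul_nonneg n_mA_H_y_c_a_ab hH_y_c_a_ab))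 (mul_nonneg n_mA_Fe hFe)) (mul_nonneg n_mA_AGabc hAGabc)) (mul_nonneg n_mB_AGabc (mul_nonneg hρ hAGabc))) (mul_nonneg n_mA_AGaby hAGaby)) (mul_nonneg n_mB_AGaby (mul_nonneg hρ hAGaby))) (mul_nonneg n_mA_AGacy hAGacy)) (mul_nonneg n_mB_AGacy (mul_nonneg hρ hAGacy))) (mul_nonneg n_mA_AGbcy hAGbcy)) (mul_nonneg n_mB_AGbcy (mul_nonneg hρ hAGbcy))) (mul_nonneg n_mA_AGe hAGe)) (mul_nonneg n_mB_AGe (mul_nonneg hρ hAGe))) (n_cA)) (mul_nonneg hρ n_cB)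
  have hMP : 0 ≤ (1 : ℝ) * pM.denote (ctx15 x₁ x₂ x₃ x₄ x₅ x₆ x₇ x₈ x₉ x₁₀ x₁₁ x₁₂ x₁₃ x₁₄ x₁₅) - (x₃ ^ 2 + x₄ ^ 2 + x₇ ^ 2 + x₈ ^ 2 + x₉ ^ 2 + x₁₀ ^ 2 + x₁₂ ^ 2 + x₁₃ ^ 2 + x₁₄ ^ 2 + x₁₅ ^ 2) := by
    have h0 := denote_nonneg_of_coeffsP (ctx15 x₁ x₂ x₃ x₄ x₅ x₆ x₇ x₈ x₉ x₁₀ x₁₁ x₁₂ x₁₃ x₁₄ x₁₅) hx _ checkM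
    rw [denote_mergeP, denote_smulP, denote_smulP, denote_applyT, denote_constP, denote_toPP _ eSq wf_all.2.2.2.2.2.2.2.2.2.2.2.2.2.2.2.2.2, eSq_denote,
      mono_one] at h0
    push_cast at h0
    linarith only [h0]
  by_cases hz : x₃ ^ 2 + x₄ ^ 2 + x₇ ^ 2 + x₈ ^ 2 + x₉ ^ 2 + x₁₀ ^ 2 + x₁₂ ^ 2 + x₁₃ ^ 2 + x₁₄ ^ 2 + x₁₅ ^ 2 = 0
  · -- every cell outside the `b`-isolated face vanishes: there `polL₁ = 0`
    have z₃ : x₃ = 0 := (pow_eq_zero_iff two_ne_zero).mp (by linarith only [hz, sq_nonneg x₃, sq_nonneg x₄, sq_nonneg x₇, sq_nonneg x₈, sq_nonneg x₉, sq_nonneg x₁₀, sq_nonneg x₁₂, sq_nonneg x₁₃, sq_nonneg x₁₄, sq_nonneg x₁₅])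
    have z₄ : x₄ = 0 := (pow_eq_zero_iff two_ne_zero).mp (by linarith only [hz, sq_nonneg x₃, sq_nonneg x₄, sq_nonneg x₇, sq_nonneg x₈, sq_nonneg x₉, sq_nonneg x₁₀, sq_nonneg x₁₂, sq_nonneg x₁₃, sq_nonneg x₁₄, sq_nonneg x₁₅])
    have z₇ : x₇ = 0 := (pow_eq_zero_iff two_ne_zero).mp (by linarith only [hz, sq_nonneg x₃, sq_nonneg x₄, sq_nonneg x₇, sq_nonneg x₈, sq_nonneg x₉, sq_nonneg x₁₀, sq_nonneg x₁₂, sq_nonneg x₁₃, sq_nonneg x₁₄, sq_nonneg x₁₅])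
    have z₈ : x₈ = 0 := (pow_eq_zero_iff two_ne_zero).mp (by linarith only [hz, sq_nonneg x₃, sq_nonneg x₄, sq_nonneg x₇, sq_nonneg x₈, sq_nonneg x₉, sq_nonneg x₁₀, sq_nonneg x₁₂, sq_nonneg x₁₃, sq_nonneg x₁₄, sq_nonneg x₁₅])
    have z₉ : x₉ = 0 := (pow_eq_zero_iff two_ne_zero).mp (by linarith only [hz, sq_nonneg x₃, sq_nonneg x₄, sq_nonneg x₇, sq_nonneg x₈, sq_nonneg x₉, sq_nonneg x₁₀, sq_nonneg x₁₂, sq_nonneg x₁₃, sq_nonneg x₁₄, sq_nonneg x₁₅])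
    have z₁₀ : x₁₀ = 0 := (pow_eq_zero_iff two_ne_zero).mp (by linarith only [hz, sq_nonneg x₃, sq_nonneg x₄, sq_nonneg x₇, sq_nonneg x₈, sq_nonneg x₉, sq_nonneg x₁₀, sq_nonneg x₁₂, sq_nonneg x₁₃, sq_nonneg x₁₄, sq_nonneg x₁₅])
    have z₁₂ : x₁₂ = 0 := (pow_eq_zero_iff two_ne_zero).mp (by linarith only [hz, sq_nonneg x₃, sq_nonneg x₄, sq_nonneg x₇, sq_nonneg x₈, sq_nonneg x₉, sq_nonneg x₁₀, sq_nonneg x₁₂, sq_nonneg x₁₃, sq_nonneg x₁₄, sq_nonneg x₁₅])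
    have z₁₃ : x₁₃ = 0 := (pow_eq_zero_iff two_ne_zero).mp (by linarith only [hz, sq_nonneg x₃, sq_nonneg x₄, sq_nonneg x₇, sq_nonneg x₈, sq_nonneg x₉, sq_nonneg x₁₀, sq_nonneg x₁₂, sq_nonneg x₁₃, sq_nonneg x₁₄, sq_nonneg x₁₅])
    have z₁₄ : x₁₄ = 0 := (pow_eq_zero_iff two_ne_zero).mp (by linarith only [hz, sq_nonneg x₃, sq_nonneg x₄, sq_nonneg x₇, sq_nonneg x₈, sq_nonneg x₉, sq_nonneg x₁₀, sq_nonneg x₁₂, sq_nonneg x₁₃, sq_nonneg x₁₄, sq_nonneg x₁₅])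
    have z₁₅ : x₁₅ = 0 := (pow_eq_zero_iff two_ne_zero).mp (by linarith only [hz, sq_nonneg x₃, sq_nonneg x₄, sq_nonneg x₇, sq_nonneg x₈, sq_nonneg x₉, sq_nonneg x₁₀, sq_nonneg x₁₂, sq_nonneg x₁₃, sq_nonneg x₁₄, sq_nonneg x₁₅])
    subst z₃ z₄ z₇ z₈ z₉ z₁₀ z₁₂ z₁₃ z₁₄ z₁₅
    simp only [polL₁, hybE₁, hybE₂, E3h]
    ring_nf
    exact le_refl _
  · have hP : 0 < x₃ ^ 2 + x₄ ^ 2 + x₇ ^ 2 + x₈ ^ 2 + x₉ ^ 2 + x₁₀ ^ 2 + x₁₂ ^ 2 + x₁₃ ^ 2 + x₁₄ ^ 2 + x₁₅ ^ 2 := lt_of_le_of_ne (by positivity) (Ne.symm hz)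
    have hM : 0 < pM.denote (ctx15 x₁ x₂ x₃ x₄ x₅ x₆ x₇ x₈ x₉ x₁₀ x₁₁ x₁₂ x₁₃ x₁₄ x₁₅) := by linarith only [hMP, hP]
    exact (mul_nonneg_iff_of_pos_left hM).mp hR

end L1ThmCert

end Summit.CriticalPhenomena.PercolationContinuityZ3.Theorems
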